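import Mathlib
import HarnessLib
import Summits.Ventures.LatticeQCDFlow.Exactness.CPNMetropolisKicks
import Summits.Ventures.LatticeQCDFlow.Exactness.SymmetricMetropolis

/-!
# The angular-Gaussian site kick of `cpn_2d` is symmetric for the uniform sphere measure: the site Metropolis hit is exact

HONEST FRAMING: exact (Metropolis-corrected) sampling algorithms for lattice gauge theory;
figures of merit are autocorrelation/cost numbers at stated couplings and volumes; no
continuum-physics claim.

Venture `LatticeQCDFlow` (cell pub-lqcd), topic `Exactness`, FANOUT row 9 (eng-latcore, the
engine `latflow.core.cpn_2d.metropolis_sites`: propose `z' = (z + ε η)/|z + ε η|`, `η` standard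
Gaussian, accept `min(1, e^{−ΔS})`).  NEW WORK of the cell over the tree (`RadialPolar.lean`: polar
coordinates `lintegral_dirSphere_norm`; `StdGaussianRadial.lean`: `stdGaussian = gaussRadial ‖·‖ · vol`;
`CPNMetropolisKicks.lean`: `angularGaussKick`; `SymmetricMetropolis.lean`: `symMH`, `symMH_invariant`
— a Metropolis hit with a symmetric proposal is exact); Mathlib's `map_addHaar_smul`,
`map_add_left_eq_self`, Tonelli.  Nothing is cited as a fact.  Printed counterpart, NAMED ONLY: the
angular (projected) Gaussian law, e.g. Mardia–Jupp, *Directional Statistics* §9.3.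

THE POINT.  The proposal law of the site kick from `w` has a DENSITY against the (un-normalised)
sphere measure, `k(w, s) = |ε|^{−d} ∫₀^∞ γ_d(|r s − w|/ε) r^{d−1} dr` (polar coordinates after the
affine change of variables `x = w + εη`), and for unit `w, s` one has `|r s − w| = |r w − s|`, so
`k(w, s) = k(s, w)`: the kick is SYMMETRIC with respect to the uniform law of the sphere, which is
exactly the hypothesis of `symMH_invariant`.

* §1 `norm_smul_dirSphere` (`‖x‖ • dir x = x`), `lintegral_comp_affine` (`∫ h(w + εη) dη =
  |ε^{−d}| ∫ h`), `angularGaussDensity ε w s` (the `k` above; jointly measurable),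
  **`lintegral_angularGaussKick`** — `∫ g d(angularGaussKick ε w) = ∫ g(s) k(w,s) d(vol.toSphere)(s)`;
  `norm_smul_sub_comm` (`|r s − w| = |r w − s|` for unit vectors), **`angularGaussDensity_comm`**.
* §2 `angularGaussKernel ε : Kernel S S` (`= angularGaussKick ε ·`, a Markov kernel);
  **`compProd_angularGaussKernel_swap`** — `(uniformSphere ⊗ₘ K).map swap = uniformSphere ⊗ₘ K`;
  **`cpnSiteMetropolis_invariant`** — for every measurable weight `p > 0` the Metropolis hit
  `symMH (angularGaussKernel ε) p` leaves `p · uniformSphere` invariant: the `cpn_2d` site Metropolis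
  update of ONE site (the others frozen, `p = ` the conditional weight `e^{κ⟨m, z⟩}`) is EXACT.

NOT CLAIMED: the lattice sweep (sites and links as one scan on the CP(N−1) configuration space) and
its ergodicity — the Doeblin inputs are `CPNMetropolisKicks.lean`, the assembly is to do; any formula
for `k` beyond its definition as an integral.
-/

noncomputable section

namespace Summit.Ventures.LatticeQCDFlow.Exactness

open MeasureTheory Measure Metric Set ProbabilityTheory Function
open scoped ENNReal NNReal RealInnerProductSpace

variable {ι : Type*} [Fintype ι] [Nonempty ι]

/-! ## §1 The density of the kick in polar coordinates -/

/-- `‖x‖ • dir x = x` (also at `x = 0`). -/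
theorem norm_smul_dirSphere (x : EuclideanSpace ℝ ι) :
    ‖x‖ • ((dirSphere x : sphere (0 : EuclideanSpace ℝ ι) 1) : EuclideanSpace ℝ ι) = x := by
  by_cases hx : x = 0
  · rw [hx, norm_zero, zero_smul]
  · rw [dirSphere_coe hx, smul_smul, mul_inv_cancel₀ (norm_ne_zero_iff.2 hx), one_smul]

omit [Nonempty ι] in
/-- **Affine change of variables** for Lebesgue measure: `∫ h(w + ε η) dη = |ε^{−d}| ∫ h(x) dx`. -/
theorem lintegral_comp_affine {ε : ℝ} (hε : ε ≠ 0) (w : EuclideanSpace ℝ ι) {h : EuclideanSpace ℝ ι → ℝ≥0∞}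
    (hh : Measurable h) :
    ∫⁻ η, h (w + ε • η) ∂volume =
      ENNReal.ofReal |(ε ^ Module.finrank ℝ (EuclideanSpace ℝ ι))⁻¹| * ∫⁻ x, h x ∂volume := by
  have hT : (fun η : EuclideanSpace ℝ ι => w + ε • η) = (fun x => w + x) ∘ fun η => ε • η := rfl
  have hmap : Measure.map (fun η : EuclideanSpace ℝ ι => w + ε • η) volume =
      ENNReal.ofReal |(ε ^ Module.finrank ℝ (EuclideanSpace ℝ ι))⁻¹| • volume := by
    rw [hT, ← Measure.map_map (measurable_const_add w) (measurable_const_smul ε), Measure.map_addHaar_smul volume hε,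
      Measure.map_smul, map_add_left_eq_self]
  rw [← lintegral_map hh ((measurable_const_smul ε).const_add w), hmap, lintegral_smul_measure, smul_eq_mul]

/-- The integrand of the kick density in polar coordinates: `((w, s), r) ↦ γ_d(|ε⁻¹(r s − w)|)`. -/
def angularGaussIntegrand (ε : ℝ)
    (q : (EuclideanSpace ℝ ι × sphere (0 : EuclideanSpace ℝ ι) 1) × Ioi (0 : ℝ)) : ℝ≥0∞ :=
  gaussRadial (Fintype.card ι) ‖ε⁻¹ • (((q.2 : ℝ) • (q.1.2 : EuclideanSpace ℝ ι)) - q.1.1)‖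

omit [Nonempty ι] in
/-- The integrand is jointly measurable. -/
theorem measurable_angularGaussIntegrand (ε : ℝ) : Measurable (angularGaussIntegrand (ι := ι) ε) := by
  have hA : Measurable fun q : (EuclideanSpace ℝ ι × sphere (0 : EuclideanSpace ℝ ι) 1) × Ioi (0 : ℝ) =>
      (q.2 : ℝ) • (q.1.2 : EuclideanSpace ℝ ι) :=
    (measurable_subtype_coe.comp measurable_snd).smul
      (continuous_subtype_val.measurable.comp (measurable_snd.comp measurable_fst))
  have hB : Measurable fun q : (EuclideanSpace ℝ ι × sphere (0 : EuclideanSpace ℝ ι) 1) × Ioi (0 : ℝ) =>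
      ε⁻¹ • (((q.2 : ℝ) • (q.1.2 : EuclideanSpace ℝ ι)) - q.1.1) :=
    (hA.sub (measurable_fst.comp measurable_fst)).const_smul ε⁻¹
  exact (measurable_gaussRadial _).comp (measurable_norm.comp hB)

/-- **The density of the angular-Gaussian kick** against `vol.toSphere`, as a function of the pair
`(w, s)`: `k(w, s) = |ε^{−d}| ∫₀^∞ γ_d(|ε⁻¹ (r s − w)|) r^{d−1} dr`. -/
def angularGaussDensity (ε : ℝ) (q : EuclideanSpace ℝ ι × sphere (0 : EuclideanSpace ℝ ι) 1) : ℝ≥0∞ :=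
  ENNReal.ofReal |(ε ^ Module.finrank ℝ (EuclideanSpace ℝ ι))⁻¹| *
    ∫⁻ r, angularGaussIntegrand ε (q, r) ∂(volumeIoiPow (Module.finrank ℝ (EuclideanSpace ℝ ι) - 1))

omit [Nonempty ι] in
/-- The inner radial integral is measurable in `(w, s)`. -/
theorem measurable_angularGaussRadialIntegral (ε : ℝ) :
    Measurable fun q : EuclideanSpace ℝ ι × sphere (0 : EuclideanSpace ℝ ι) 1 =>
      ∫⁻ r, angularGaussIntegrand ε (q, r) ∂(volumeIoiPow (Module.finrank ℝ (EuclideanSpace ℝ ι) - 1)) :=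
  (measurable_angularGaussIntegrand ε).lintegral_prod_right'

omit [Nonempty ι] in
/-- `k` is jointly measurable. -/
theorem measurable_angularGaussDensity (ε : ℝ) : Measurable (angularGaussDensity (ι := ι) ε) :=
  (measurable_angularGaussRadialIntegral ε).const_mul _

/-- **THE KICK IN POLAR COORDINATES**: `∫ g d(angularGaussKick ε w) = ∫ g(s) k(w, s) d(vol.toSphere)(s)`
for measurable `g ≥ 0` and `ε ≠ 0`. -/
theorem lintegral_angularGaussKick {ε : ℝ} (hε : ε ≠ 0) (w : EuclideanSpace ℝ ι)
    {g : sphere (0 : EuclideanSpace ℝ ι) 1 → ℝ≥0∞} (hg : Measurable g) :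
    ∫⁻ s, g s ∂(angularGaussKick ε w) =
      ∫⁻ s, g s * angularGaussDensity ε (w, s) ∂((volume : Measure (EuclideanSpace ℝ ι)).toSphere) := by
  have hγ : Measurable fun x : EuclideanSpace ℝ ι => gaussRadial (Fintype.card ι) ‖x‖ :=
    (measurable_gaussRadial _).comp measurable_norm
  have hFm : Measurable fun η : EuclideanSpace ℝ ι => dirSphere (w + ε • η) :=
    measurable_dirSphere.comp (measurable_affineKick ε w)
  have hgF : Measurable fun η : EuclideanSpace ℝ ι => g (dirSphere (w + ε • η)) := hg.comp hFm
  have hmeas : Measurable fun x : EuclideanSpace ℝ ι => g (dirSphere x) * gaussRadial (Fintype.card ι) ‖ε⁻¹ • (x - w)‖ :=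
    (hg.comp measurable_dirSphere).mul (hγ.comp ((measurable_id.sub_const w).const_smul ε⁻¹))
  -- the kick as a Lebesgue integral
  have h1 : ∫⁻ s, g s ∂(angularGaussKick ε w) =
      ∫⁻ η, g (dirSphere (w + ε • η)) * gaussRadial (Fintype.card ι) ‖η‖ ∂volume := by
    rw [angularGaussKick, lintegral_map hg hFm, stdGaussian_eq_withDensity_radial,
      lintegral_withDensity_eq_lintegral_mul _ hγ hgF]
    exact lintegral_congr fun η => mul_comm _ _
  -- the affine change of variables `x = w + ε η`
  have hη : ∀ η : EuclideanSpace ℝ ι, ε⁻¹ • ((w + ε • η) - w) = η := fun η => by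
    rw [add_sub_cancel_left, smul_smul, inv_mul_cancel₀ hε, one_smul]
  have h2 : ∫⁻ η, g (dirSphere (w + ε • η)) * gaussRadial (Fintype.card ι) ‖η‖ ∂volume =
      ENNReal.ofReal |(ε ^ Module.finrank ℝ (EuclideanSpace ℝ ι))⁻¹| *
        ∫⁻ x, g (dirSphere x) * gaussRadial (Fintype.card ι) ‖ε⁻¹ • (x - w)‖ ∂volume := by
    rw [← lintegral_comp_affine hε w hmeas]
    refine lintegral_congr fun η => ?_
    simp only [hη]
  -- polar coordinates
  have hA : Measurable fun p : sphere (0 : EuclideanSpace ℝ ι) 1 × ℝ => p.2 • (p.1 : EuclideanSpace ℝ ι) :=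
    measurable_snd.smul (continuous_subtype_val.measurable.comp measurable_fst)
  have hB : Measurable fun p : sphere (0 : EuclideanSpace ℝ ι) 1 × ℝ => ε⁻¹ • (p.2 • (p.1 : EuclideanSpace ℝ ι) - w) :=
    (hA.sub_const w).const_smul ε⁻¹
  have hF : Measurable fun p : sphere (0 : EuclideanSpace ℝ ι) 1 × ℝ =>
      g p.1 * gaussRadial (Fintype.card ι) ‖ε⁻¹ • ((p.2 • (p.1 : EuclideanSpace ℝ ι)) - w)‖ :=
    (hg.comp measurable_fst).mul ((measurable_gaussRadial _).comp (measurable_norm.comp hB))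
  have h3 : ∫⁻ x, g (dirSphere x) * gaussRadial (Fintype.card ι) ‖ε⁻¹ • (x - w)‖ ∂volume =
      ∫⁻ p, g p.1 * gaussRadial (Fintype.card ι) ‖ε⁻¹ • ((((p.2 : ℝ)) • (p.1 : EuclideanSpace ℝ ι)) - w)‖
        ∂((volume : Measure (EuclideanSpace ℝ ι)).toSphere.prod (volumeIoiPow (Module.finrank ℝ (EuclideanSpace ℝ ι) - 1))) := by
    have h := lintegral_dirSphere_norm (volume : Measure (EuclideanSpace ℝ ι)) hF
    simp only [norm_smul_dirSphere] at h
    exact h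
  have hF' : Measurable fun p : sphere (0 : EuclideanSpace ℝ ι) 1 × Ioi (0 : ℝ) =>
      g p.1 * gaussRadial (Fintype.card ι) ‖ε⁻¹ • ((((p.2 : ℝ)) • (p.1 : EuclideanSpace ℝ ι)) - w)‖ :=
    hF.comp (measurable_fst.prodMk (measurable_subtype_coe.comp measurable_snd))
  have hJ : Measurable fun s : sphere (0 : EuclideanSpace ℝ ι) 1 =>
      ∫⁻ r, angularGaussIntegrand ε ((w, s), r) ∂(volumeIoiPow (Module.finrank ℝ (EuclideanSpace ℝ ι) - 1)) :=
    (measurable_angularGaussRadialIntegral ε).comp (measurable_const.prodMk measurable_id)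
  have hgJ : Measurable fun s : sphere (0 : EuclideanSpace ℝ ι) 1 =>
      g s * ∫⁻ r, angularGaussIntegrand ε ((w, s), r) ∂(volumeIoiPow (Module.finrank ℝ (EuclideanSpace ℝ ι) - 1)) :=
    hg.mul hJ
  have hRHS : ∫⁻ s, g s * angularGaussDensity ε (w, s) ∂((volume : Measure (EuclideanSpace ℝ ι)).toSphere) =
      ENNReal.ofReal |(ε ^ Module.finrank ℝ (EuclideanSpace ℝ ι))⁻¹| *
        ∫⁻ s, g s * ∫⁻ r, angularGaussIntegrand ε ((w, s), r) ∂(volumeIoiPow (Module.finrank ℝ (EuclideanSpace ℝ ι) - 1))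
          ∂((volume : Measure (EuclideanSpace ℝ ι)).toSphere) := by
    rw [← lintegral_const_mul _ hgJ]
    refine lintegral_congr fun s => ?_
    rw [angularGaussDensity]
    ring
  rw [h1, h2, h3, lintegral_prod _ hF'.aemeasurable, hRHS]
  congr 1
  refine lintegral_congr fun s => ?_
  have hI : Measurable fun r : Ioi (0 : ℝ) => angularGaussIntegrand ε ((w, s), r) :=
    (measurable_angularGaussIntegrand ε).comp (measurable_const.prodMk measurable_id)
  rw [← lintegral_const_mul _ hI]
  rfl

omit [Nonempty ι] in
/-- For unit vectors, `|r s − w| = |r w − s|`. -/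
theorem norm_smul_sub_comm {s w : EuclideanSpace ℝ ι} (hs : ‖s‖ = 1) (hw : ‖w‖ = 1) (r : ℝ) :
    ‖r • s - w‖ = ‖r • w - s‖ := by
  have h1 : ‖r • s - w‖ ^ 2 = ‖r • w - s‖ ^ 2 := by
    rw [@norm_sub_sq_real, @norm_sub_sq_real, norm_smul, norm_smul, hs, hw, inner_smul_left, inner_smul_left,
      real_inner_comm s w]
  exact (pow_left_inj₀ (norm_nonneg _) (norm_nonneg _) two_ne_zero).1 h1

omit [Nonempty ι] in
/-- **`k` is symmetric on the sphere**: `k(w, s) = k(s, w)` for unit `w`, `s`. -/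
theorem angularGaussDensity_comm (ε : ℝ) (w s : sphere (0 : EuclideanSpace ℝ ι) 1) :
    angularGaussDensity ε ((w : EuclideanSpace ℝ ι), s) = angularGaussDensity ε ((s : EuclideanSpace ℝ ι), w) := by
  unfold angularGaussDensity angularGaussIntegrand
  congr 1
  refine lintegral_congr fun r => ?_
  simp only
  rw [norm_smul, norm_smul, norm_smul_sub_comm (by simp) (by simp)]

/-! ## §2 The kernel, its symmetry, exactness of the site Metropolis hit -/

/-- **The angular-Gaussian proposal kernel on the sphere** (`cpn_2d.metropolis_sites`). -/
def angularGaussKernel (ε : ℝ) : Kernel (sphere (0 : EuclideanSpace ℝ ι) 1) (sphere (0 : EuclideanSpace ℝ ι) 1) :=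
  Kernel.map (Kernel.const _ (stdGaussian (EuclideanSpace ℝ ι)) ×ₖ Kernel.deterministic id measurable_id)
    (fun q : EuclideanSpace ℝ ι × sphere (0 : EuclideanSpace ℝ ι) 1 => dirSphere ((q.2 : EuclideanSpace ℝ ι) + ε • q.1))

/-- The kick map is jointly measurable. -/
theorem measurable_angularKickMap (ε : ℝ) :
    Measurable fun q : EuclideanSpace ℝ ι × sphere (0 : EuclideanSpace ℝ ι) 1 =>
      dirSphere ((q.2 : EuclideanSpace ℝ ι) + ε • q.1) :=
  measurable_dirSphere.comp ((continuous_subtype_val.measurable.comp measurable_snd).add (measurable_fst.const_smul ε))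

/-- The kernel at `w` is the kick law `angularGaussKick ε w`. -/
theorem angularGaussKernel_apply (ε : ℝ) (w : sphere (0 : EuclideanSpace ℝ ι) 1) :
    angularGaussKernel ε w = angularGaussKick ε (w : EuclideanSpace ℝ ι) := by
  rw [angularGaussKernel, Kernel.map_apply _ (measurable_angularKickMap ε), Kernel.prod_apply, Kernel.const_apply,
    Kernel.deterministic_apply, Measure.prod_dirac, Measure.map_map (measurable_angularKickMap ε) measurable_prodMk_right]
  rfl

/-- The kernel is Markov. -/
instance isMarkovKernel_angularGaussKernel (ε : ℝ) : IsMarkovKernel (angularGaussKernel (ι := ι) ε) := by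
  unfold angularGaussKernel; exact Kernel.IsMarkovKernel.map _ (measurable_angularKickMap ε)

/-- Integration against the kernel, in polar form. -/
theorem lintegral_angularGaussKernel {ε : ℝ} (hε : ε ≠ 0) (w : sphere (0 : EuclideanSpace ℝ ι) 1)
    {g : sphere (0 : EuclideanSpace ℝ ι) 1 → ℝ≥0∞} (hg : Measurable g) :
    ∫⁻ s, g s ∂(angularGaussKernel ε w) =
      ∫⁻ s, g s * angularGaussDensity ε ((w : EuclideanSpace ℝ ι), s) ∂((volume : Measure (EuclideanSpace ℝ ι)).toSphere) := by
  rw [angularGaussKernel_apply, lintegral_angularGaussKick hε _ hg]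

omit [Nonempty ι] in
/-- **The symmetric double integral**: `∫∫ f(s, w) k(w, s) = ∫∫ f(w, s) k(w, s)` over `vol.toSphere²`
(Tonelli and `k(w, s) = k(s, w)`). -/
theorem lintegral_lintegral_angularGaussDensity_symm (ε : ℝ)
    {f : sphere (0 : EuclideanSpace ℝ ι) 1 × sphere (0 : EuclideanSpace ℝ ι) 1 → ℝ≥0∞} (hf : Measurable f) :
    ∫⁻ w, ∫⁻ s, f (s, w) * angularGaussDensity ε ((w : EuclideanSpace ℝ ι), s)
        ∂(volume : Measure (EuclideanSpace ℝ ι)).toSphere ∂(volume : Measure (EuclideanSpace ℝ ι)).toSphere =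
      ∫⁻ w, ∫⁻ s, f (w, s) * angularGaussDensity ε ((w : EuclideanSpace ℝ ι), s)
        ∂(volume : Measure (EuclideanSpace ℝ ι)).toSphere ∂(volume : Measure (EuclideanSpace ℝ ι)).toSphere := by
  have hk : Measurable fun q : sphere (0 : EuclideanSpace ℝ ι) 1 × sphere (0 : EuclideanSpace ℝ ι) 1 =>
      angularGaussDensity ε ((q.1 : EuclideanSpace ℝ ι), q.2) :=
    (measurable_angularGaussDensity ε).comp ((continuous_subtype_val.measurable.comp measurable_fst).prodMk measurable_snd)
  have hm : Measurable (Function.uncurry fun (w s : sphere (0 : EuclideanSpace ℝ ι) 1) =>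
      f (s, w) * angularGaussDensity ε ((w : EuclideanSpace ℝ ι), s)) :=
    (hf.comp measurable_swap).mul hk
  rw [lintegral_lintegral_swap hm.aemeasurable]
  refine lintegral_congr fun s => lintegral_congr fun w => ?_
  rw [angularGaussDensity_comm]

/-- **THE KICK IS SYMMETRIC FOR THE UNIFORM SPHERE MEASURE**: `(σ ⊗ₘ K).map swap = σ ⊗ₘ K`,
`σ = uniformSphere volume` (`ε ≠ 0`). -/
theorem compProd_angularGaussKernel_swap {ε : ℝ} (hε : ε ≠ 0) :
    (uniformSphere (volume : Measure (EuclideanSpace ℝ ι)) ⊗ₘ angularGaussKernel ε).map Prod.swap =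
      uniformSphere (volume : Measure (EuclideanSpace ℝ ι)) ⊗ₘ angularGaussKernel ε := by
  refine Measure.ext_of_lintegral _ (fun f hf => ?_)
  have hm1 : ∀ w : sphere (0 : EuclideanSpace ℝ ι) 1, Measurable fun s : sphere (0 : EuclideanSpace ℝ ι) 1 => f (s, w) :=
    fun w => hf.comp (measurable_id.prodMk measurable_const)
  have hm2 : ∀ w : sphere (0 : EuclideanSpace ℝ ι) 1, Measurable fun s : sphere (0 : EuclideanSpace ℝ ι) 1 => f (w, s) :=
    fun w => hf.comp measurable_prodMk_left
  rw [lintegral_map hf measurable_swap,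
    Measure.lintegral_compProd (f := fun z => f z.swap) (hf.comp measurable_swap),
    Measure.lintegral_compProd hf]
  have h1 : ∀ w : sphere (0 : EuclideanSpace ℝ ι) 1,
      ∫⁻ s, (fun z : sphere (0 : EuclideanSpace ℝ ι) 1 × sphere (0 : EuclideanSpace ℝ ι) 1 => f z.swap) (w, s)
        ∂(angularGaussKernel ε w) =
      ∫⁻ s, f (s, w) * angularGaussDensity ε ((w : EuclideanSpace ℝ ι), s) ∂((volume : Measure (EuclideanSpace ℝ ι)).toSphere) :=
    fun w => lintegral_angularGaussKernel hε w (hm1 w)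
  have h2 : ∀ w : sphere (0 : EuclideanSpace ℝ ι) 1, ∫⁻ s, f (w, s) ∂(angularGaussKernel ε w) =
      ∫⁻ s, f (w, s) * angularGaussDensity ε ((w : EuclideanSpace ℝ ι), s) ∂((volume : Measure (EuclideanSpace ℝ ι)).toSphere) :=
    fun w => lintegral_angularGaussKernel hε w (hm2 w)
  simp_rw [h1, h2]
  rw [uniformSphere, lintegral_smul_measure, lintegral_smul_measure, lintegral_lintegral_angularGaussDensity_symm ε hf]

/-- **THE `cpn_2d` SITE METROPOLIS HIT IS EXACT**: for every measurable weight `p > 0` on the sphere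
and every `ε ≠ 0`, the Metropolis kernel with the angular-Gaussian proposal,
`symMH (angularGaussKernel ε) p`, leaves `p · uniformSphere` invariant. -/
theorem cpnSiteMetropolis_invariant {ε : ℝ} (hε : ε ≠ 0) {p : sphere (0 : EuclideanSpace ℝ ι) 1 → ℝ}
    (hp : Measurable p) (hp0 : ∀ s, 0 < p s) :
    Kernel.Invariant (symMH (angularGaussKernel ε) p)
      ((uniformSphere (volume : Measure (EuclideanSpace ℝ ι))).withDensity fun s => ENNReal.ofReal (p s)) :=
  symMH_invariant hp hp0 (compProd_angularGaussKernel_swap hε)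

end Summit.Ventures.LatticeQCDFlow.Exactness
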